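import Mathlib.Analysis.Matrix.Order
import Mathlib.Analysis.SpecialFunctions.Pow.Real
import Summits.Ventures.CertifiedManyBodySolver.Conjectures.OneBodySection

/-!
# The three-site one-body window, solved at every density: `E¹_[3](n) = −√(2n(2−n))` on `2/3 ≤ n ≤ 4/3`

HONEST FRAMING: first certified bounds; not a superconductivity verdict; every number certified
or labelled float.  (Venture `CertifiedManyBodySolver`, programme `hubbard-alg`, team M1 seat 4,
structure notes `STRUCTURE-TM1-doped.md`, entries T-M1D.31 / C-M1D-21 'two-shell closed form'.)

Setting (`OneBodySection.lean`): per-species one-body data `g : ℕ → ℝ` of a translation-invariant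
(pseudo-)state, `g 0 = ν` (density per spin, total density `n = 2ν`), window constraint
`0 ⪯ T_S(g) ⪯ 1`; the window value is `E¹_[S](n) = min (−4 · g 1)`.

This file solves the smallest Pauli-sensitive window, `S = 3`, in CLOSED FORM for every density:

* `hop_le` — for all `0 < ν < 1`: `g 0 = ν ∧ 0 ⪯ T_3(g) ⪯ 1 → g 1 ≤ √(ν(1−ν)/2)`;
* `attained` — for `1/3 ≤ ν ≤ 2/3` the point `g⋆ = (ν, √(ν(1−ν)/2), 1 − 2ν)` is feasible, so
  `max g 1 = √(ν(1−ν)/2)` there, i.e. `E¹_[3](n) = −√(2n(2−n))` for `2/3 ≤ n ≤ 4/3`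
  (outside that range the bound is the band-bottom value `g 1 ≤ min(ν, 1−ν)` of `hop_le_diag`
  and particle–hole symmetry, and `√(ν(1−ν)/2)` is not attained).

It is the `S = 3` instance of the TWO-SHELL CLOSED FORM (C-M1D-21): for `1 < Sν ≤ 2` the window
optimum is `ν cos k⋆` with `sin(S k⋆)/sin k⋆ = 2/ν − S`; here `4cos²k⋆ − 1 = 2/ν − 3`, i.e.
`cos²k⋆ = (1−ν)/(2ν)` and `ν cos k⋆ = √(ν(1−ν)/2)`.  PROOF = the one-sided Chebyshev certificate
with ONE Pauli-tight direction `w = (c, 1, c)` and the double zero `a = (1, −2c, 1)` (`c = cos k⋆`):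
`c²·aᵀT a + wᵀ(1 − T)w = 2(1−ν)(1+2c²) − 4c(1+2c²)·g 1 ≥ 0`.  Attainment: `g⋆` is the two-atom
measure `(ν/2)(δ_{k⋆} + δ_{−k⋆})`, whose section has eigenvalues `1, 3ν − 1, 0` — two explicit
sums of squares below.  Everything is `ring`/`linear_combination` over `ℝ`; no numerics.
-/

namespace Summit.Ventures.CertifiedManyBodySolver.Conjectures.ToeplitzWindowThree

open Matrix Summit.Ventures.CertifiedManyBodySolver.Conjectures

/-- The `3 × 3` Toeplitz section written out. -/
def T3 (g : ℕ → ℝ) : Matrix (Fin 3) (Fin 3) ℝ :=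
  !![g 0, g 1, g 2;
     g 1, g 0, g 1;
     g 2, g 1, g 0]

/-- `toeplitzSection 3 g` is the explicit matrix `T3 g`. -/
theorem T3_eq (g : ℕ → ℝ) : toeplitzSection 3 g = T3 g := by
  ext i j
  fin_cases i <;> fin_cases j <;> rfl

/-- `T3 g` is symmetric. -/
theorem T3_isHermitian (g : ℕ → ℝ) : (T3 g).IsHermitian := by
  unfold T3
  refine Matrix.IsHermitian.ext fun i j => ?_
  fin_cases i <;> fin_cases j <;> simp

/-- **Certificate (algebraic form).** If `c > 0` and `2νc² = 1 − ν` then every `g` with `g 0 = ν`,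
`0 ⪯ T_3(g) ⪯ 1` has `g 1 ≤ (1 − ν)/(2c)` (`= ν c`). -/
theorem hop_le_of_relation {g : ℕ → ℝ} {ν c : ℝ} (hc : 0 < c) (hrel : 2 * ν * c ^ 2 = 1 - ν)
    (hT : (toeplitzSection 3 g).PosSemidef) (hI : (1 - toeplitzSection 3 g).PosSemidef)
    (h0 : g 0 = ν) : g 1 ≤ (1 - ν) / (2 * c) := by
  rw [T3_eq] at hT hI
  have q2 := (Matrix.posSemidef_iff_dotProduct_mulVec.mp hT).2 ![(1 : ℝ), (-2 : ℝ) * c, (1 : ℝ)]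
  have q3 := (Matrix.posSemidef_iff_dotProduct_mulVec.mp hI).2 ![c, (1 : ℝ), c]
  have e2 : star ![(1 : ℝ), (-2 : ℝ) * c, (1 : ℝ)] ⬝ᵥ (T3 g *ᵥ ![(1 : ℝ), (-2 : ℝ) * c, (1 : ℝ)])
      = ν * (2 + 4 * c ^ 2) - 8 * c * g 1 + 2 * g 2 := by
    simp [T3, Matrix.mulVec, dotProduct, Fin.sum_univ_succ, h0]
    ring
  have e3 : star ![c, (1 : ℝ), c] ⬝ᵥ ((1 - T3 g) *ᵥ ![c, (1 : ℝ), c])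
      = (1 + 2 * c ^ 2) - ν * (1 + 2 * c ^ 2) - 4 * c * g 1 - 2 * c ^ 2 * g 2 := by
    simp [T3, Matrix.mulVec, dotProduct, Fin.sum_univ_succ, h0, Matrix.sub_apply, Matrix.one_apply]
    ring
  rw [e2] at q2
  rw [e3] at q3
  have hz : 2 * ν * c ^ 2 - (1 - ν) = 0 := by linarith
  have key : (1 + 2 * c ^ 2) * (2 * c * g 1 - (1 - ν))
      = -(1 / 2) * (c ^ 2 * (ν * (2 + 4 * c ^ 2) - 8 * c * g 1 + 2 * g 2)
          + ((1 + 2 * c ^ 2) - ν * (1 + 2 * c ^ 2) - 4 * c * g 1 - 2 * c ^ 2 * g 2))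
        + (1 + 2 * c ^ 2) / 2 * (2 * ν * c ^ 2 - (1 - ν)) := by
    ring
  have hprod : (1 + 2 * c ^ 2) * (2 * c * g 1 - (1 - ν)) ≤ 0 := by
    rw [key, hz]
    have := mul_nonneg (sq_nonneg c) q2
    linarith
  have hpos : 0 < 1 + 2 * c ^ 2 := by positivity
  have hlin : 2 * c * g 1 - (1 - ν) ≤ 0 := by
    by_contra h
    have := mul_pos hpos (not_le.mp h)
    linarith
  rw [le_div_iff₀ (by positivity)]
  linarith

/-- **`E¹_[3](2ν) ≥ −4√(ν(1−ν)/2)` for every density.**  For `0 < ν < 1`, every `g` with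
`g 0 = ν` and `0 ⪯ T_3(g) ⪯ 1` has `g 1 ≤ √(ν(1−ν)/2)`. -/
theorem hop_le {g : ℕ → ℝ} {ν : ℝ} (hν : 0 < ν) (hν1 : ν < 1)
    (hT : (toeplitzSection 3 g).PosSemidef) (hI : (1 - toeplitzSection 3 g).PosSemidef)
    (h0 : g 0 = ν) : g 1 ≤ Real.sqrt (ν * (1 - ν) / 2) := by
  set c := Real.sqrt ((1 - ν) / (2 * ν)) with hc_def
  have hin : 0 < (1 - ν) / (2 * ν) := by
    apply div_pos <;> linarith
  have hc : 0 < c := Real.sqrt_pos.mpr hin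
  have hc2 : c ^ 2 = (1 - ν) / (2 * ν) := Real.sq_sqrt hin.le
  have hrel : 2 * ν * c ^ 2 = 1 - ν := by
    rw [hc2]
    field_simp
  have h := hop_le_of_relation hc hrel hT hI h0
  have hy : 0 < (1 - ν) / (2 * c) := by
    apply div_pos <;> linarith
  have heq : Real.sqrt (ν * (1 - ν) / 2) = (1 - ν) / (2 * c) := by
    rw [Real.sqrt_eq_iff_mul_self_eq_of_pos hy]
    have hcne : c ≠ 0 := ne_of_gt hc
    have hνne : ν ≠ 0 := ne_of_gt hν
    field_simp
    nlinarith [hrel]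
  rw [heq]
  exact h

/-- The optimal point for `1/3 ≤ ν ≤ 2/3`: `g⋆ = (ν, √(ν(1−ν)/2), 1 − 2ν)` (`g⋆ j = ν cos(j k⋆)`). -/
noncomputable def gOpt (ν : ℝ) : ℕ → ℝ
  | 0 => ν
  | 1 => Real.sqrt (ν * (1 - ν) / 2)
  | 2 => 1 - 2 * ν
  | _ => 0

/-- `T_3(g⋆) ⪰ 0` for `1/3 ≤ ν`: `2ν²·xᵀT_3(g⋆)x = 2ν(νx₀ + b x₁ + (1−2ν)x₂)² + (3ν−1)(νx₁ + 2b x₂)²`,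
`b = √(ν(1−ν)/2)`. -/
theorem opt_posSemidef {ν : ℝ} (hν : 1 / 3 ≤ ν) (hν1 : ν < 1) :
    (toeplitzSection 3 (gOpt ν)).PosSemidef := by
  rw [T3_eq]
  have hνpos : 0 < ν := by linarith
  set b := Real.sqrt (ν * (1 - ν) / 2) with hb_def
  have hb2 : b ^ 2 = ν * (1 - ν) / 2 := Real.sq_sqrt (by nlinarith)
  refine Matrix.posSemidef_iff_dotProduct_mulVec.mpr ⟨T3_isHermitian _, fun x => ?_⟩
  have e : star x ⬝ᵥ (T3 (gOpt ν) *ᵥ x)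
      = ν * (x 0 ^ 2 + x 1 ^ 2 + x 2 ^ 2) + 2 * b * (x 0 * x 1 + x 1 * x 2)
        + 2 * (1 - 2 * ν) * (x 0 * x 2) := by
    simp [T3, gOpt, Matrix.mulVec, dotProduct, Fin.sum_univ_succ, ← hb_def]
    ring
  rw [e]
  have key : 2 * ν ^ 2 * (ν * (x 0 ^ 2 + x 1 ^ 2 + x 2 ^ 2) + 2 * b * (x 0 * x 1 + x 1 * x 2)
        + 2 * (1 - 2 * ν) * (x 0 * x 2))
      = 2 * ν * (ν * x 0 + b * x 1 + (1 - 2 * ν) * x 2) ^ 2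
        + (3 * ν - 1) * (ν * x 1 + 2 * b * x 2) ^ 2 := by
    linear_combination (-(2 * ν * x 1 ^ 2 + 4 * (3 * ν - 1) * x 2 ^ 2)) * hb2
  have hR : 0 ≤ 2 * ν * (ν * x 0 + b * x 1 + (1 - 2 * ν) * x 2) ^ 2
        + (3 * ν - 1) * (ν * x 1 + 2 * b * x 2) ^ 2 := by
    have h1 : 0 ≤ 3 * ν - 1 := by linarith
    positivity
  have h2 : 0 < 2 * ν ^ 2 := by positivity
  exact (mul_nonneg_iff_of_pos_left h2).mp (key ▸ hR)

/-- `T_3(g⋆) ⪯ 1` for `ν ≤ 2/3`: `2ν·xᵀ(1 − T_3(g⋆))x = ν(2−3ν)(x₀ − x₂)² + (νx₀ − 2b x₁ + νx₂)²`. -/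
theorem opt_le_one {ν : ℝ} (hν : 0 < ν) (hν1 : ν ≤ 2 / 3) :
    (1 - toeplitzSection 3 (gOpt ν)).PosSemidef := by
  rw [T3_eq]
  set b := Real.sqrt (ν * (1 - ν) / 2) with hb_def
  have hb2 : b ^ 2 = ν * (1 - ν) / 2 := Real.sq_sqrt (by nlinarith)
  have hH : (1 - T3 (gOpt ν)).IsHermitian := (Matrix.isHermitian_one).sub (T3_isHermitian _)
  refine Matrix.posSemidef_iff_dotProduct_mulVec.mpr ⟨hH, fun x => ?_⟩
  have e : star x ⬝ᵥ ((1 - T3 (gOpt ν)) *ᵥ x)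
      = (1 - ν) * (x 0 ^ 2 + x 1 ^ 2 + x 2 ^ 2) - 2 * b * (x 0 * x 1 + x 1 * x 2)
        - 2 * (1 - 2 * ν) * (x 0 * x 2) := by
    simp [T3, gOpt, Matrix.mulVec, dotProduct, Fin.sum_univ_succ, ← hb_def, Matrix.sub_apply,
      Matrix.one_apply]
    ring
  rw [e]
  have key : 2 * ν * ((1 - ν) * (x 0 ^ 2 + x 1 ^ 2 + x 2 ^ 2) - 2 * b * (x 0 * x 1 + x 1 * x 2)
        - 2 * (1 - 2 * ν) * (x 0 * x 2))
      = ν * (2 - 3 * ν) * (x 0 - x 2) ^ 2 + (ν * x 0 - 2 * b * x 1 + ν * x 2) ^ 2 := by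
    linear_combination (-(4 * x 1 ^ 2)) * hb2
  have hR : 0 ≤ ν * (2 - 3 * ν) * (x 0 - x 2) ^ 2 + (ν * x 0 - 2 * b * x 1 + ν * x 2) ^ 2 := by
    have h1 : 0 ≤ 2 - 3 * ν := by linarith
    positivity
  have h2 : 0 < 2 * ν := by positivity
  exact (mul_nonneg_iff_of_pos_left h2).mp (key ▸ hR)

/-- **`E¹_[3](n) = −√(2n(2−n))` on `2/3 ≤ n ≤ 4/3` is attained.**  For `1/3 ≤ ν ≤ 2/3` there is a
feasible `g` with `g 0 = ν` and `g 1 = √(ν(1−ν)/2)`, so `hop_le` is sharp there. -/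
theorem attained {ν : ℝ} (hν : 1 / 3 ≤ ν) (hν1 : ν ≤ 2 / 3) :
    ∃ g : ℕ → ℝ, g 0 = ν ∧ g 1 = Real.sqrt (ν * (1 - ν) / 2) ∧
      (toeplitzSection 3 g).PosSemidef ∧ (1 - toeplitzSection 3 g).PosSemidef :=
  ⟨gOpt ν, rfl, rfl, opt_posSemidef hν (by linarith), opt_le_one (by linarith) hν1⟩

end Summit.Ventures.CertifiedManyBodySolver.Conjectures.ToeplitzWindowThree
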